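import Literature.Combinatorics.LorentzianPolynomials.StrictlyLorentzianQuadratic
import HarnessLib

/-!
# Brändén–Huh Lemma 2.15 and Theorem 2.16 (1): the Hessian of a strictly Lorentzian polynomial is nonsingular on `ℝ^n_{>0}`

Layer `Literature/Combinatorics/LorentzianPolynomials`, namespace `Literature.Combinatorics.LorentzianPolynomials`;
lane `lit-hodgefound` (Track 2 foundations library), seat p16, generation 29 (row g29-#11). The tree has Theorem 2.16
(2) (`HodgeRiemann.sigPos_hessianAt_eq_one_of_mem_lorentzian`: "exactly one positive eigenvalue" on `ℝ^n_{>0}` for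
`f ∈ L^d_n`). This file adds the missing half of the Hodge–Riemann statement: **Lemma 2.15** (the kernel of `𝓗_f(w)` is
the intersection of the kernels of the `𝓗_{∂_i f}(w)`) and **Theorem 2.16 (1)** (`𝓗_f(w)` is nonsingular for
`f ∈ L̊^d_n`, `w ∈ ℝ^n_{>0}`), hence the full Lorentzian signature `(+, -, …, -)` of `𝓗_f(w)` on `L̊^d_n`. The source
derives (1) for `L̊^d_n` "from induction and Lemma 2.15"; (2) it obtains by connectedness and continuity of
eigenvalues — the tree's (2) comes instead from Cor. 2.11, and is used here as the input "`𝓗_{∂_i f}(w)` has exactly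
one positive eigenvalue" of Lemma 2.15.

## Source (verbatim) — P. Brändén, J. Huh, *Lorentzian polynomials* [BrandenHuh2019] (held `paper:arxiv-1902.03719`)

§2.3 (pp. 17–18): "**Lemma 2.15.** If `𝓗_{∂_i f}(w)` has exactly one positive eigenvalue for every `i ∈ [n]` and
`w ∈ ℝ^n_{>0}`, then `ker 𝓗_f(w) = ⋂_{i=1}^n ker 𝓗_{∂_i f}(w)` for every `w ∈ ℝ^n_{>0}`. *Proof.* We may suppose
`d ≥ 3`. Fix `w ∈ ℝ^n_{>0}`, and write `𝓗_f` for `𝓗_f(w)`. We will use Euler's formula for homogeneous functions: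
`d f = Σ_{i=1}^n w_i ∂_i f`. It follows that the Hessians of `f` and `∂_i f` satisfy the relation
`(d-2) 𝓗_f = Σ_{i=1}^n w_i 𝓗_{∂_i f}`, and hence the kernel of `𝓗_f` contains the intersection of the kernels of
`𝓗_{∂_i f}`. For the other inclusion, let `z` be a vector in the kernel of `𝓗_f`. By Euler's formula again,
`(d-2) e_iᵀ 𝓗_f = wᵀ 𝓗_{∂_i f}` for every `i ∈ [n]`, and hence `wᵀ 𝓗_{∂_i f} z = 0` for every `i ∈ [n]`. We have
`wᵀ 𝓗_{∂_i f} w > 0` because `∂_i f` is nonzero and has nonnegative coefficients. Since `𝓗_{∂_i f}(w)` has exactly one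
positive eigenvalue, it follows that `𝓗_{∂_i f}` is negative semidefinite on the kernel of `wᵀ 𝓗_{∂_i f}`. In
particular, `zᵀ 𝓗_{∂_i f} z ≤ 0`, with equality if and only if `𝓗_{∂_i f} z = 0`. To conclude, we write zero as the
positive linear combination `0 = (d-2)(zᵀ 𝓗_f z) = Σ_{i=1}^n w_i (zᵀ 𝓗_{∂_i f} z)`. Since every summand in the
right-hand side is non-positive by the previous analysis, we must have `zᵀ 𝓗_{∂_i f} z = 0` for every `i ∈ [n]`, and
hence `𝓗_{∂_i f} z = 0` for every `i ∈ [n]`. […] **Theorem 2.16.** Let `f` be a nonzero homogeneous polynomial in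
`ℝ[w_1, …, w_n]` of degree `d ≥ 2`. (1) If `f` is in `L̊^d_n`, then `𝓗_f(w)` is nonsingular for all `w ∈ ℝ^n_{>0}`.
(2) If `f` is in `L^d_n`, then `𝓗_f(w)` has exactly one positive eigenvalue for all `w ∈ ℝ^n_{>0}`. *Proof.* […] We
prove (1) and (2) simultaneously by induction on `d` […]. The base case `d = 2` is trivial. We suppose that `d ≥ 3`
and that the theorem holds for `L̊^{d-1}_n`. That (1) holds for `L̊^d_n` follows from induction and Lemma 2.15."

## What is here

* §1 Euler's relation for Hessians at a point: `Σ_i w_i 𝓗_{∂_i f}(w) = (d-2) 𝓗_f(w)` entrywise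
  (`sum_mul_hessianAt_pderiv`), and the kernel of a symmetric matrix through its bilinear form.
* §2 **Lemma 2.15** (`hessianAt_mulVec_eq_zero_iff`), with the hypotheses it actually uses: every `𝓗_{∂_i f}(w)` has at
  most one positive square and `wᵀ𝓗_{∂_i f}(w)w > 0`; "equality iff `𝓗_{∂_i f} z = 0`" is Cauchy–Schwarz on `w^⊥`
  (`LorentzianReverseSchwarz.sq_le_mul_of_orthogonal`).
* §3 **Theorem 2.16 (1)** (`det_hessianAt_ne_zero_of_mem_strictlyLorentzian`) by induction on the degree, and the
  Lorentzian signature of `𝓗_f(w)` on `L̊^d_n` (`sigPos_sigNeg_hessianAt_of_mem_strictlyLorentzian`).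

Theorems only; no `sorry`, no named fact (net debt 0).

## References

* [BrandenHuh2019] P. Brändén, J. Huh, *Lorentzian polynomials*, Ann. of Math. (2) 192 (2020) 821–891, arXiv:1902.03719 —
  §2.3 Lemma 2.15, Thm. 2.16 (pp. 17–18).
* [Serre1973] J.-P. Serre, *A course in arithmetic*, GTM 7, Ch. V §1.3.2 (Sylvester's law of inertia).
-/

noncomputable section

open MvPolynomial Finsupp Finset Module
open Literature.LinearAlgebra.QuadraticForm

namespace Literature.Combinatorics.LorentzianPolynomials

variable {σ : Type*} [Fintype σ] [DecidableEq σ]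

/-! ## §1 Euler's relation for the Hessians at a point -/

section Euler

omit [DecidableEq σ] in
/-- **"`(d-2) 𝓗_f = Σ_{i=1}^n w_i 𝓗_{∂_i f}`"** at the point `w`, entrywise — Euler's formula for the degree-`(d-2)`
forms `∂_j ∂_k f`; the same identity reads "`(d-2) e_iᵀ 𝓗_f = wᵀ 𝓗_{∂_i f}`". [cite: BrandenHuh2019, §2.3 proof of
Lemma 2.15 (p. 17)] -/
theorem sum_mul_hessianAt_pderiv {f : MvPolynomial σ ℝ} {d : ℕ} (hf : f.IsHomogeneous d) (w : σ → ℝ) (j k : σ) :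
    ∑ i, w i * hessianAt (pderiv i f) w j k = ((d - 2 : ℕ) : ℝ) * hessianAt f w j k := by
  have hjk : (pderiv j (pderiv k f)).IsHomogeneous (d - 2) := by
    have h := (hf.pderiv (i := k)).pderiv (i := j)
    rwa [show d - 1 - 1 = d - 2 by omega] at h
  rw [hessianAt_apply, ← sum_mul_eval_pderiv hjk w]
  refine Finset.sum_congr rfl fun i _ ↦ ?_
  rw [hessianAt_apply, pderiv_pderiv_comm k i, pderiv_pderiv_comm j i]

/-- A symmetric matrix kills `z` iff its bilinear form vanishes on `(·, z)`. [cite: BrandenHuh2019, §2.3 proof of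
Lemma 2.15 ("and hence `𝓗_{∂_i f} z = 0`")] [cite: Serre1973, Ch. V §1.3.2] -/
theorem mulVec_eq_zero_iff_forall_toBilin'_eq_zero (H : Matrix σ σ ℝ) (z : σ → ℝ) :
    H.mulVec z = 0 ↔ ∀ y, Matrix.toBilin' H y z = 0 := by
  constructor
  · intro h y
    rw [Matrix.toBilin'_apply', h, dotProduct_zero]
  · intro h
    ext k
    have hk := h (Pi.single k 1)
    rwa [Matrix.toBilin'_apply', single_dotProduct, one_mul] at hk

end Euler

/-! ## §2 Lemma 2.15 -/

section Lemma215

/-- **Brändén–Huh, Lemma 2.15: `ker 𝓗_f(w) = ⋂_i ker 𝓗_{∂_i f}(w)`** for `w ∈ ℝ^n_{>0}` and `f` homogeneous of degree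
`d ≥ 3`, provided each `𝓗_{∂_i f}(w)` has at most one positive square and `wᵀ 𝓗_{∂_i f}(w) w > 0` (what "exactly one
positive eigenvalue" and "`∂_i f` is nonzero and has nonnegative coefficients" supply in the source). Proof as printed:
`⊇` from `(d-2)𝓗_f = Σ w_i 𝓗_{∂_i f}`; `⊆`: `wᵀ𝓗_{∂_i f} z = (d-2)(𝓗_f z)_i = 0`, so `zᵀ𝓗_{∂_i f}z ≤ 0`
(`self_nonpos_of_orthogonal_of_self_pos`), the `w_i`-weighted sum of these is `(d-2) zᵀ𝓗_f z = 0`, so each vanishes,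
and then `𝓗_{∂_i f} z = 0` by Cauchy–Schwarz on `w^⊥` (`sq_le_mul_of_orthogonal`). [cite: BrandenHuh2019, §2.3
Lemma 2.15 (pp. 17–18)] -/
theorem hessianAt_mulVec_eq_zero_iff {f : MvPolynomial σ ℝ} {d : ℕ} (hf : f.IsHomogeneous d) (hd : 3 ≤ d)
    {w : σ → ℝ} (hw : ∀ k, 0 < w k)
    (h1 : ∀ i, sigPos (Matrix.toBilin' (hessianAt (pderiv i f) w)).toQuadraticMap ≤ 1)
    (hpos : ∀ i, 0 < Matrix.toBilin' (hessianAt (pderiv i f) w) w w) (z : σ → ℝ) :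
    (hessianAt f w).mulVec z = 0 ↔ ∀ i, (hessianAt (pderiv i f) w).mulVec z = 0 := by
  have hd2 : ((d - 2 : ℕ) : ℝ) ≠ 0 := by exact_mod_cast (by omega : d - 2 ≠ 0)
  -- abbreviations for the forms
  set B : LinearMap.BilinForm ℝ (σ → ℝ) := Matrix.toBilin' (hessianAt f w) with hB
  set Bi : σ → LinearMap.BilinForm ℝ (σ → ℝ) := fun i ↦ Matrix.toBilin' (hessianAt (pderiv i f) w) with hBi
  have hsymm : ∀ i, LinearMap.IsSymm (Bi i) := fun i ↦ isSymm_toBilin'_of_isSymm (isSymm_hessianAt _ _)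
  have hsymmB : LinearMap.IsSymm B := isSymm_toBilin'_of_isSymm (isSymm_hessianAt _ _)
  -- (E1) `Σ_i w_i B_i(y, z) = (d-2) B(y, z)` ("`(d-2) 𝓗_f = Σ w_i 𝓗_{∂_i f}`")
  have hE1 : ∀ y, ∑ i, w i * Bi i y z = ((d - 2 : ℕ) : ℝ) * B y z := fun y ↦ by
    simp only [hBi, hB, Matrix.toBilin'_apply, Finset.mul_sum]
    rw [Finset.sum_comm]
    refine Finset.sum_congr rfl fun j _ ↦ ?_
    rw [Finset.sum_comm]
    refine Finset.sum_congr rfl fun k _ ↦ ?_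
    have h := sum_mul_hessianAt_pderiv hf w j k
    calc ∑ i, w i * (y j * hessianAt (pderiv i f) w j k * z k)
        = y j * (∑ i, w i * hessianAt (pderiv i f) w j k) * z k := by
          rw [Finset.mul_sum, Finset.sum_mul]
          exact Finset.sum_congr rfl fun i _ ↦ by ring
      _ = ((d - 2 : ℕ) : ℝ) * (y j * hessianAt f w j k * z k) := by rw [h]; ring
  -- (E3) `B_i(w, z) = (d-2) B(e_i, z)` ("`(d-2) e_iᵀ 𝓗_f = wᵀ 𝓗_{∂_i f}`")
  have hE3 : ∀ i, Bi i w z = ((d - 2 : ℕ) : ℝ) * B (Pi.single i 1) z := fun i ↦ by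
    simp only [hBi, hB, Matrix.toBilin'_apply]
    have hR : ∑ j, ∑ k, (Pi.single i 1 : σ → ℝ) j * hessianAt f w j k * z k = ∑ k, hessianAt f w i k * z k := by
      rw [Finset.sum_eq_single_of_mem i (Finset.mem_univ i) fun j _ hj ↦ ?_]
      · simp only [Pi.single_eq_same, one_mul]
      · simp only [Pi.single_eq_of_ne hj, zero_mul, Finset.sum_const_zero]
    rw [hR, Finset.mul_sum, Finset.sum_comm]
    refine Finset.sum_congr rfl fun k _ ↦ ?_
    have h := sum_mul_hessianAt_pderiv hf w i k
    have h3 : ∀ j, hessianAt (pderiv i f) w j k = hessianAt (pderiv j f) w i k := fun j ↦ by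
      rw [hessianAt_apply, hessianAt_apply, pderiv_pderiv_comm k i, pderiv_pderiv_comm j i,
        pderiv_pderiv_comm j k]
    calc ∑ j, w j * hessianAt (pderiv i f) w j k * z k = (∑ j, w j * hessianAt (pderiv j f) w i k) * z k := by
          rw [Finset.sum_mul]
          exact Finset.sum_congr rfl fun j _ ↦ by rw [h3 j]
      _ = ((d - 2 : ℕ) : ℝ) * (hessianAt f w i k * z k) := by rw [h]; ring
  rw [mulVec_eq_zero_iff_forall_toBilin'_eq_zero]
  simp only [mulVec_eq_zero_iff_forall_toBilin'_eq_zero]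
  change (∀ y, B y z = 0) ↔ ∀ i y, Bi i y z = 0
  constructor
  · intro hz i
    -- `wᵀ 𝓗_{∂_i f} z = 0`
    have hwz : ∀ i, Bi i z w = 0 := fun i ↦ by
      rw [symm_apply (hsymm i) z w, hE3 i, hz, mul_zero]
    -- each `zᵀ 𝓗_{∂_i f} z ≤ 0`, and their `w`-weighted sum is `(d-2) zᵀ 𝓗_f z = 0`
    have hle : ∀ i, Bi i z z ≤ 0 := fun i ↦
      self_nonpos_of_orthogonal_of_self_pos (Bi i) (hsymm i) (h1 i) (hpos i) (hwz i)
    have hsum : ∑ i, w i * Bi i z z = 0 := by rw [hE1 z, hz z, mul_zero]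
    have hzero : Bi i z z = 0 := by
      have hterm : ∀ i ∈ (Finset.univ : Finset σ), w i * Bi i z z ≤ 0 := fun i _ ↦
        mul_nonpos_of_nonneg_of_nonpos (hw i).le (hle i)
      have h := (Finset.sum_eq_zero_iff_of_nonpos hterm).1 hsum i (Finset.mem_univ i)
      exact (mul_eq_zero.1 h).resolve_left (hw i).ne'
    -- Cauchy–Schwarz on `w^⊥`: `B_i(z, y') = 0` for `y' ⊥ w`, hence `B_i(z, y) = 0` for all `y`
    intro y
    have hyw : Bi i (y - (Bi i y w / Bi i w w) • w) w = 0 := by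
      rw [map_sub, map_smul, LinearMap.sub_apply, LinearMap.smul_apply, smul_eq_mul,
        div_mul_cancel₀ _ (hpos i).ne', sub_self]
    have hcs := sq_le_mul_of_orthogonal (Bi i) (hsymm i) (h1 i) (hpos i) (hwz i) hyw
    rw [hzero, zero_mul] at hcs
    have h0 : Bi i z (y - (Bi i y w / Bi i w w) • w) = 0 :=
      pow_eq_zero_iff two_ne_zero |>.1 (le_antisymm hcs (sq_nonneg _))
    rw [map_sub, map_smul, smul_eq_mul, hwz i, mul_zero, sub_zero] at h0
    rw [symm_apply (hsymm i) y z]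
    exact h0
  · intro hz y
    have h := hE1 y
    simp only [hz, mul_zero, Finset.sum_const_zero] at h
    exact (mul_eq_zero.1 h.symm).resolve_left hd2

end Lemma215

/-! ## §3 Theorem 2.16 (1) -/

section Theorem216

omit [Fintype σ] [DecidableEq σ] in
/-- A polynomial all of whose degree-`d` coefficients are positive is nonzero (given an index `i`).
[cite: BrandenHuh2019, §2.3 proof of Lemma 2.15 ("`∂_i f` is nonzero")] -/
theorem ne_zero_of_forall_coeff_pos {d : ℕ} {f : MvPolynomial σ ℝ} (i : σ)
    (hpos : ∀ α : σ →₀ ℕ, α.degree = d → 0 < coeff α f) : f ≠ 0 := by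
  intro h
  have h1 := hpos (Finsupp.single i d) (degree_single i d)
  rw [h, coeff_zero] at h1
  exact lt_irrefl 0 h1

/-- **Brändén–Huh, Theorem 2.16 (1): "If `f` is in `L̊^d_n`, then `𝓗_f(w)` is nonsingular for all `w ∈ ℝ^n_{>0}`"**
(`d ≥ 2`; for the tree's Definition-2.1 `strictlyLorentzian`). By induction on `d`: for `d = 2`, `𝓗_f(w) = 𝓗_f` is
nonsingular by definition; for `d ≥ 3`, a kernel vector of `𝓗_f(w)` lies in every `ker 𝓗_{∂_i f}(w)` by Lemma 2.15
(whose hypothesis "exactly one positive eigenvalue" is Theorem 2.16 (2) for `∂_i f ∈ L^{d-1}_n`, in the tree), and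
`∂_i f ∈ L̊^{d-1}_n`. [cite: BrandenHuh2019, §2.3 Thm. 2.16 (1) (p. 18)] -/
theorem det_hessianAt_ne_zero_of_mem_strictlyLorentzian :
    ∀ {m : ℕ} {f : MvPolynomial σ ℝ}, f ∈ strictlyLorentzian σ (m + 2) → ∀ {w : σ → ℝ}, (∀ k, 0 < w k) →
      (hessianAt f w).det ≠ 0
  | 0, f, hf, w, _ => by
    obtain ⟨hhom, -, hdet, -⟩ := mem_strictlyLorentzian_two.1 hf
    rwa [hessianAt_eq_hessian hhom]
  | m + 1, f, hf, w, hw => by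
    have hhom := isHomogeneous_of_mem_strictlyLorentzian hf
    have hpos := coeff_pos_of_mem_strictlyLorentzian hf
    have hdi : ∀ i, pderiv i f ∈ strictlyLorentzian σ (m + 2) := fun i ↦ pderiv_mem_strictlyLorentzian hf i
    -- Lemma 2.15's hypotheses for the `∂_i f ∈ L̊^{m+2}_n ⊆ L^{m+2}_n`
    have h1 : ∀ i, sigPos (Matrix.toBilin' (hessianAt (pderiv i f) w)).toQuadraticMap ≤ 1 := fun i ↦
      sigPos_hessianAt_le_one_of_mem_lorentzian' (mem_lorentzian_of_mem_strictlyLorentzian (hdi i)) le_add_self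
        fun k ↦ (hw k).le
    have hwpos : ∀ i, 0 < Matrix.toBilin' (hessianAt (pderiv i f) w) w w := fun i ↦ by
      have hhomi := isHomogeneous_of_mem_strictlyLorentzian (hdi i)
      rw [toBilin'_hessianAt_self hhomi w]
      have hne : pderiv i f ≠ 0 := ne_zero_of_forall_coeff_pos i (coeff_pos_of_mem_strictlyLorentzian (hdi i))
      have hev := eval_pos_of_coeff_nonneg (coeff_nonneg_of_mem_lorentzian
        (mem_lorentzian_of_mem_strictlyLorentzian (hdi i))) hne hw
      have h1' : (0 : ℝ) < ((m + 2 : ℕ) : ℝ) := by positivity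
      have h2' : (0 : ℝ) < ((m + 2 - 1 : ℕ) : ℝ) := by exact_mod_cast (by omega : 0 < m + 2 - 1)
      exact mul_pos (mul_pos h1' h2') hev
    intro hdet
    obtain ⟨z, hz0, hz⟩ := Matrix.exists_mulVec_eq_zero_iff.2 hdet
    obtain ⟨k, hk⟩ := Function.ne_iff.1 hz0
    have hker := (hessianAt_mulVec_eq_zero_iff hhom (by omega) hw h1 hwpos z).1 hz k
    exact det_hessianAt_ne_zero_of_mem_strictlyLorentzian (hdi k) hw (Matrix.exists_mulVec_eq_zero_iff.1 ⟨z, hz0, hker⟩)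

/-- Theorem 2.16 (1) with the degree hypothesis `2 ≤ d`. [cite: BrandenHuh2019, §2.3 Thm. 2.16 (1)] -/
theorem det_hessianAt_ne_zero_of_mem_strictlyLorentzian' {d : ℕ} {f : MvPolynomial σ ℝ}
    (hf : f ∈ strictlyLorentzian σ d) (hd : 2 ≤ d) {w : σ → ℝ} (hw : ∀ k, 0 < w k) : (hessianAt f w).det ≠ 0 := by
  obtain ⟨m, rfl⟩ : ∃ m, d = m + 2 := ⟨d - 2, by omega⟩
  exact det_hessianAt_ne_zero_of_mem_strictlyLorentzian hf hw

/-- **The Hodge–Riemann signature on `L̊^d_n`**: for `f ∈ L̊^d_n` (`d ≥ 2`, `n ≥ 1`) and `w ∈ ℝ^n_{>0}`, `𝓗_f(w)` has the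
Lorentzian signature `(+, -, …, -)` — `sigPos = 1` (Theorem 2.16 (2)) and `sigNeg = n - 1` (Theorem 2.16 (1) and
Sylvester). [cite: BrandenHuh2019, §2.3 Thm. 2.16 (1), (2)] [cite: Serre1973, Ch. V §1.3.2] -/
theorem sigPos_sigNeg_hessianAt_of_mem_strictlyLorentzian [Nonempty σ] {d : ℕ} {f : MvPolynomial σ ℝ}
    (hf : f ∈ strictlyLorentzian σ d) (hd : 2 ≤ d) {w : σ → ℝ} (hw : ∀ k, 0 < w k) :
    sigPos (Matrix.toBilin' (hessianAt f w)).toQuadraticMap = 1 ∧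
      sigNeg (Matrix.toBilin' (hessianAt f w)).toQuadraticMap = Fintype.card σ - 1 := by
  obtain ⟨i⟩ := ‹Nonempty σ›
  have hf0 : f ≠ 0 := ne_zero_of_forall_coeff_pos i (coeff_pos_of_mem_strictlyLorentzian hf)
  have hsig := sigPos_hessianAt_eq_one_of_mem_lorentzian (mem_lorentzian_of_mem_strictlyLorentzian hf) hd hf0 hw
  have hdet := det_hessianAt_ne_zero_of_mem_strictlyLorentzian' hf hd hw
  have hsum := LinearMap.BilinForm.sigPos_add_sigNeg_eq_finrank_of_isSymm (Matrix.toBilin' (hessianAt f w))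
    (LinearMap.BilinForm.isSymm_iff.2 (isSymm_toBilin'_of_isSymm (isSymm_hessianAt f w)))
    (fun x hx ↦ eq_zero_of_forall_toBilin'_eq_zero hdet fun y ↦ by
      rw [symm_apply (isSymm_toBilin'_of_isSymm (isSymm_hessianAt f w)) y x]; exact hx y)
  rw [finrank_fintype_fun_eq_card, hsig] at hsum
  exact ⟨hsig, by omega⟩

end Theorem216

end Literature.Combinatorics.LorentzianPolynomials

end
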